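import Summits.MatrixMultiplication.MatrixMultiplication.Theorems.PairwiseCurvedTilingsLC.Negative.ChartIdealSucc
import Summits.MatrixMultiplication.MatrixMultiplication.Theorems.PairwiseCurvedTilingsLC.Negative.GenericSimpleRoots
import Mathlib.Algebra.MvPolynomial.Equiv
import Mathlib.RingTheory.Ideal.Maps

/-!
# `PairwiseCurvedTilingsLC` (crux stmt-MatrixMultiplication-17883), line `LonelyTranslates` (c1):
the lifted chart ideal is maximal

Helper stub `stub_liftedChartIdeal_isMaximal` (H9) of the chart induction (`stub_openPiece`) in
the skeleton `Cruxes/PairwiseCurvedTilingsLC/Lines/LonelyTranslates.lean`.  Pure commutative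
algebra.

Let `K` be a field, `R = K[u_1, …, u_e]`, `F = Frac R`, and let
`toFw_k : K[u, w_1, …, w_k] → F[w_1, …, w_k]` be the canonical `K`-algebra map
(`u_i ↦ C (u_i / 1)`, `w_j ↦ w_j`).  A chart is a tuple `D_1, …, D_k ∈ K[u, w]` whose images
`toFw_k (D_j)` generate a maximal ideal `I ⊆ F[w]`.  Given `Q ∈ K[u, w][t]` whose image
`q̃ = Q.map toFw_k ∈ F[w][t]` has irreducible reduction modulo `I`, the lifted chart on
`K[u, w_0, w_1, …, w_k]` (old `w_j` renamed to `w_{j+1}`, the new bound variable `w_0`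
substituted for `t` in `Q`) is `Dnew = (Q(w_0), D_1, …, D_k)`, and the theorem says that the
images `toFw_{k+1} (Dnew_j)` again generate a maximal ideal of `F[w_0, …, w_k]`.

Proof.  Naturality `toFw_{k+1} ∘ rename (w_j ↦ w_{j+1}) = rename Fin.succ ∘ toFw_k`
(`aeval_sumElim_rename_sumMap_succ`, two `K`-algebra maps agreeing on variables) and
`toFw_{k+1} (Q(w_0)) = (finSuccEquiv F k).symm q̃` (`aeval_sumElim_eval₂_rename_X_inr_zero`,
from `Polynomial.hom_eval₂`, `Polynomial.eval₂_map` and `rename Fin.succ = finSuccEquiv.symm ∘ C`)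
identify the lifted chart ideal with `span (insert ((finSuccEquiv F k).symm q̃) (rename Fin.succ '' I))`,
which is maximal by `stub_chartIdeal_succ_isMaximal` (file `ChartIdealSucc.lean`).
Elementary, sorry-free, def-free.
-/

set_option linter.dupNamespace false  -- `Summit.<S>.<S>.…` is the mandated namespace

namespace Summit.MatrixMultiplication.MatrixMultiplication.Theorems.PairwiseCurvedTilingsLC.Negative

section LiftedChartIdeal

variable {K : Type} [Field K] {e k : ℕ}

/-- Naturality in `k` of the canonical maps `toFw_k : K[u, w_1, …, w_k] → F[w_1, …, w_k]`
(`F = Frac K[u]`): shifting the bound variables `w_j ↦ w_{j+1}` before or after passing to `F`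
gives the same polynomial. [folklore] -/
theorem aeval_sumElim_rename_sumMap_succ (p : MvPolynomial (Fin e ⊕ Fin k) K) :
    MvPolynomial.aeval (Sum.elim
        (fun i => MvPolynomial.C (algebraMap (MvPolynomial (Fin e) K)
          (FractionRing (MvPolynomial (Fin e) K)) (MvPolynomial.X i)))
        (fun j => MvPolynomial.X j))
      (MvPolynomial.rename (Sum.map id Fin.succ : Fin e ⊕ Fin k → Fin e ⊕ Fin (k + 1)) p) =
    MvPolynomial.rename Fin.succ ((MvPolynomial.aeval (Sum.elim
        (fun i => MvPolynomial.C (algebraMap (MvPolynomial (Fin e) K)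
          (FractionRing (MvPolynomial (Fin e) K)) (MvPolynomial.X i)))
        (fun j => MvPolynomial.X j)) p :
          MvPolynomial (Fin k) (FractionRing (MvPolynomial (Fin e) K)))) := by
  rw [MvPolynomial.aeval_rename]
  have key : (MvPolynomial.aeval ((Sum.elim
        (fun i => MvPolynomial.C (algebraMap (MvPolynomial (Fin e) K)
          (FractionRing (MvPolynomial (Fin e) K)) (MvPolynomial.X i)))
        (fun j => MvPolynomial.X j)) ∘ (Sum.map id Fin.succ : Fin e ⊕ Fin k → Fin e ⊕ Fin (k + 1))) :
        MvPolynomial (Fin e ⊕ Fin k) K →ₐ[K]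
          MvPolynomial (Fin (k + 1)) (FractionRing (MvPolynomial (Fin e) K))) =
      ((MvPolynomial.rename Fin.succ :
          MvPolynomial (Fin k) (FractionRing (MvPolynomial (Fin e) K))
            →ₐ[FractionRing (MvPolynomial (Fin e) K)]
          MvPolynomial (Fin (k + 1)) (FractionRing (MvPolynomial (Fin e) K))).restrictScalars K).comp
        (MvPolynomial.aeval (Sum.elim
          (fun i => MvPolynomial.C (algebraMap (MvPolynomial (Fin e) K)
            (FractionRing (MvPolynomial (Fin e) K)) (MvPolynomial.X i)))
          (fun j => MvPolynomial.X j)) :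
            MvPolynomial (Fin e ⊕ Fin k) K →ₐ[K]
              MvPolynomial (Fin k) (FractionRing (MvPolynomial (Fin e) K))) := by
    refine MvPolynomial.algHom_ext fun x => ?_
    rw [MvPolynomial.aeval_X, AlgHom.comp_apply, MvPolynomial.aeval_X, AlgHom.restrictScalars_apply]
    rcases x with i | j
    · simp only [Function.comp_apply, Sum.map_inl, id_eq, Sum.elim_inl, MvPolynomial.rename_C]
    · simp only [Function.comp_apply, Sum.map_inr, Sum.elim_inr, MvPolynomial.rename_X]
  exact AlgHom.congr_fun key p

/-- Substituting the new bound variable `w_0` for the polynomial variable of `Q ∈ K[u, w][t]`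
(old `w_j` renamed to `w_{j+1}`) and passing to `F[w_0, …, w_k]` gives, under
`F[w_0, …, w_k] ≅ F[w_1, …, w_k][X]` (`MvPolynomial.finSuccEquiv`), the polynomial
`Q.map toFw_k ∈ F[w_1, …, w_k][X]`. [folklore] -/
theorem aeval_sumElim_eval₂_rename_X_inr_zero (Q : Polynomial (MvPolynomial (Fin e ⊕ Fin k) K)) :
    MvPolynomial.aeval (Sum.elim
        (fun i => MvPolynomial.C (algebraMap (MvPolynomial (Fin e) K)
          (FractionRing (MvPolynomial (Fin e) K)) (MvPolynomial.X i)))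
        (fun j => MvPolynomial.X j))
      (Q.eval₂ (MvPolynomial.rename (Sum.map id Fin.succ :
          Fin e ⊕ Fin k → Fin e ⊕ Fin (k + 1))).toRingHom (MvPolynomial.X (Sum.inr 0))) =
    (MvPolynomial.finSuccEquiv (FractionRing (MvPolynomial (Fin e) K)) k).symm
      (Q.map (MvPolynomial.aeval
        (Sum.elim (fun i => MvPolynomial.C (algebraMap (MvPolynomial (Fin e) K)
          (FractionRing (MvPolynomial (Fin e) K)) (MvPolynomial.X i)))
          (fun j => MvPolynomial.X j)) :
            MvPolynomial (Fin e ⊕ Fin k) K →ₐ[K]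
              MvPolynomial (Fin k) (FractionRing (MvPolynomial (Fin e) K))).toRingHom) := by
  set toFw : MvPolynomial (Fin e ⊕ Fin k) K →ₐ[K]
      MvPolynomial (Fin k) (FractionRing (MvPolynomial (Fin e) K)) :=
    MvPolynomial.aeval (Sum.elim
      (fun i => MvPolynomial.C (algebraMap (MvPolynomial (Fin e) K)
        (FractionRing (MvPolynomial (Fin e) K)) (MvPolynomial.X i)))
      (fun j => MvPolynomial.X j)) with htoFw
  set toFw' : MvPolynomial (Fin e ⊕ Fin (k + 1)) K →ₐ[K]
      MvPolynomial (Fin (k + 1)) (FractionRing (MvPolynomial (Fin e) K)) :=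
    MvPolynomial.aeval (Sum.elim
      (fun i => MvPolynomial.C (algebraMap (MvPolynomial (Fin e) K)
        (FractionRing (MvPolynomial (Fin e) K)) (MvPolynomial.X i)))
      (fun j => MvPolynomial.X j)) with htoFw'
  -- push `toFw'` through `eval₂`
  change toFw'.toRingHom (Q.eval₂ (MvPolynomial.rename (Sum.map id Fin.succ :
      Fin e ⊕ Fin k → Fin e ⊕ Fin (k + 1))).toRingHom (MvPolynomial.X (Sum.inr 0))) = _
  rw [Polynomial.hom_eval₂]
  have hcomp : toFw'.toRingHom.comp (MvPolynomial.rename (Sum.map id Fin.succ :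
        Fin e ⊕ Fin k → Fin e ⊕ Fin (k + 1))).toRingHom =
      (MvPolynomial.rename Fin.succ :
          MvPolynomial (Fin k) (FractionRing (MvPolynomial (Fin e) K))
            →ₐ[FractionRing (MvPolynomial (Fin e) K)]
          MvPolynomial (Fin (k + 1)) (FractionRing (MvPolynomial (Fin e) K))).toRingHom.comp
        toFw.toRingHom :=
    RingHom.ext fun p => aeval_sumElim_rename_sumMap_succ p
  have hX : toFw'.toRingHom (MvPolynomial.X (Sum.inr 0)) = MvPolynomial.X 0 := by
    change toFw' (MvPolynomial.X (Sum.inr 0)) = MvPolynomial.X 0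
    rw [htoFw', MvPolynomial.aeval_X, Sum.elim_inr]
  rw [hcomp, hX, ← Polynomial.eval₂_map, AlgHom.toRingHom_eq_coe,
    Literature.RingTheory.MvPolynomial.coe_rename_succ_eq]
  have hX0 : (MvPolynomial.X 0 : MvPolynomial (Fin (k + 1)) (FractionRing (MvPolynomial (Fin e) K))) =
      ((MvPolynomial.finSuccEquiv (FractionRing (MvPolynomial (Fin e) K)) k).symm :
        Polynomial (MvPolynomial (Fin k) (FractionRing (MvPolynomial (Fin e) K))) →+*
          MvPolynomial (Fin (k + 1)) (FractionRing (MvPolynomial (Fin e) K))) Polynomial.X := by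
    rw [RingHom.coe_coe, ← MvPolynomial.finSuccEquiv_X_zero, AlgEquiv.symm_apply_apply]
  rw [hX0, ← Polynomial.hom_eval₂, Polynomial.eval₂_C_X, RingHom.coe_coe]

/-- STUB (helper H9, the lifted chart ideal is maximal): adjoining to a chart `(D_1..D_k)` (free
`u ∈ K^e`, bound `w ∈ K^k`, chart ideal maximal in `F[w]`) a new bound coordinate (index `0`; old
`w_j` moved to `Fin.succ j`) as a root of `Q ∈ K[u,w][t]` whose image over the chart field is
irreducible, gives again a maximal chart ideal.  The lifted chart ideal is literally the ideal
`(q̃, I) ⊆ F[w_0, …, w_k]` of `stub_chartIdeal_succ_isMaximal` (`q̃ = Q.map toFw_k`), by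
naturality of `toFw` (`aeval_sumElim_rename_sumMap_succ`) and
`aeval_sumElim_eval₂_rename_X_inr_zero`. [folklore] -/
theorem stub_liftedChartIdeal_isMaximal {K : Type} [Field K] {e k : ℕ}
    (D : Fin k → MvPolynomial (Fin e ⊕ Fin k) K)
    (hmax : (Ideal.span (Set.range fun j => MvPolynomial.aeval
      (Sum.elim (fun i => MvPolynomial.C (algebraMap (MvPolynomial (Fin e) K)
        (FractionRing (MvPolynomial (Fin e) K)) (MvPolynomial.X i)))
        (fun j => MvPolynomial.X j)) (D j) :
          Set (MvPolynomial (Fin k) (FractionRing (MvPolynomial (Fin e) K))))).IsMaximal)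
    (Q : Polynomial (MvPolynomial (Fin e ⊕ Fin k) K))
    (hQ : Irreducible ((Q.map (MvPolynomial.aeval
      (Sum.elim (fun i => MvPolynomial.C (algebraMap (MvPolynomial (Fin e) K)
        (FractionRing (MvPolynomial (Fin e) K)) (MvPolynomial.X i)))
        (fun j => MvPolynomial.X j)) :
          MvPolynomial (Fin e ⊕ Fin k) K →ₐ[K]
            MvPolynomial (Fin k) (FractionRing (MvPolynomial (Fin e) K))).toRingHom).map
        (Ideal.Quotient.mk (Ideal.span (Set.range fun j => MvPolynomial.aeval
          (Sum.elim (fun i => MvPolynomial.C (algebraMap (MvPolynomial (Fin e) K)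
            (FractionRing (MvPolynomial (Fin e) K)) (MvPolynomial.X i)))
            (fun j => MvPolynomial.X j)) (D j) :
              Set (MvPolynomial (Fin k) (FractionRing (MvPolynomial (Fin e) K)))))))) :
    (Ideal.span (Set.range fun j => MvPolynomial.aeval
      (Sum.elim (fun i => MvPolynomial.C (algebraMap (MvPolynomial (Fin e) K)
        (FractionRing (MvPolynomial (Fin e) K)) (MvPolynomial.X i)))
        (fun j => MvPolynomial.X j))
      ((Fin.cons (Q.eval₂ (MvPolynomial.rename (Sum.map id Fin.succ :
          Fin e ⊕ Fin k → Fin e ⊕ Fin (k + 1))).toRingHom (MvPolynomial.X (Sum.inr 0)))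
        (fun j => MvPolynomial.rename (Sum.map id Fin.succ : Fin e ⊕ Fin k → Fin e ⊕ Fin (k + 1))
          (D j)) : Fin (k + 1) → MvPolynomial (Fin e ⊕ Fin (k + 1)) K) j) :
          Set (MvPolynomial (Fin (k + 1)) (FractionRing (MvPolynomial (Fin e) K))))).IsMaximal := by
  set toFw : MvPolynomial (Fin e ⊕ Fin k) K →ₐ[K]
      MvPolynomial (Fin k) (FractionRing (MvPolynomial (Fin e) K)) :=
    MvPolynomial.aeval (Sum.elim
      (fun i => MvPolynomial.C (algebraMap (MvPolynomial (Fin e) K)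
        (FractionRing (MvPolynomial (Fin e) K)) (MvPolynomial.X i)))
      (fun j => MvPolynomial.X j)) with htoFw
  set toFw' : MvPolynomial (Fin e ⊕ Fin (k + 1)) K →ₐ[K]
      MvPolynomial (Fin (k + 1)) (FractionRing (MvPolynomial (Fin e) K)) :=
    MvPolynomial.aeval (Sum.elim
      (fun i => MvPolynomial.C (algebraMap (MvPolynomial (Fin e) K)
        (FractionRing (MvPolynomial (Fin e) K)) (MvPolynomial.X i)))
      (fun j => MvPolynomial.X j)) with htoFw'
  set I : Ideal (MvPolynomial (Fin k) (FractionRing (MvPolynomial (Fin e) K))) :=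
    Ideal.span (Set.range fun j => toFw (D j)) with hI
  haveI : I.IsMaximal := hmax
  -- the generators of the lifted chart ideal, computed in `F[w_0, …, w_k]`
  have hfun : (fun j => toFw' ((Fin.cons (Q.eval₂ (MvPolynomial.rename (Sum.map id Fin.succ :
          Fin e ⊕ Fin k → Fin e ⊕ Fin (k + 1))).toRingHom (MvPolynomial.X (Sum.inr 0)))
        (fun j => MvPolynomial.rename (Sum.map id Fin.succ : Fin e ⊕ Fin k → Fin e ⊕ Fin (k + 1))
          (D j)) : Fin (k + 1) → MvPolynomial (Fin e ⊕ Fin (k + 1)) K) j)) =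
      Fin.cons ((MvPolynomial.finSuccEquiv (FractionRing (MvPolynomial (Fin e) K)) k).symm
          (Q.map toFw.toRingHom))
        (fun j => MvPolynomial.rename Fin.succ (toFw (D j))) := by
    funext j
    refine Fin.cases ?_ (fun j => ?_) j
    · simp only [Fin.cons_zero]
      exact aeval_sumElim_eval₂_rename_X_inr_zero Q
    · simp only [Fin.cons_succ]
      exact aeval_sumElim_rename_sumMap_succ (D j)
  have hideal : Ideal.span (Set.range (Fin.cons
      ((MvPolynomial.finSuccEquiv (FractionRing (MvPolynomial (Fin e) K)) k).symm
          (Q.map toFw.toRingHom))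
        (fun j => MvPolynomial.rename Fin.succ (toFw (D j))) :
          Fin (k + 1) → MvPolynomial (Fin (k + 1)) (FractionRing (MvPolynomial (Fin e) K)))) =
      Ideal.span (insert ((MvPolynomial.finSuccEquiv (FractionRing (MvPolynomial (Fin e) K)) k).symm
          (Q.map toFw.toRingHom))
        ((MvPolynomial.rename Fin.succ) '' (I : Set (MvPolynomial (Fin k)
          (FractionRing (MvPolynomial (Fin e) K)))))) := by
    have hrange : Set.range (fun j => MvPolynomial.rename Fin.succ (toFw (D j))) =
        (MvPolynomial.rename Fin.succ :
          MvPolynomial (Fin k) (FractionRing (MvPolynomial (Fin e) K))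
            →ₐ[FractionRing (MvPolynomial (Fin e) K)]
          MvPolynomial (Fin (k + 1)) (FractionRing (MvPolynomial (Fin e) K))) ''
          Set.range (fun j => toFw (D j)) :=
      Set.range_comp (MvPolynomial.rename Fin.succ) (fun j => toFw (D j))
    rw [Fin.range_cons, Ideal.span_insert, Ideal.span_insert, hrange,
      ← Ideal.map_span (MvPolynomial.rename Fin.succ)]
    rfl
  rw [hfun, hideal]
  exact stub_chartIdeal_succ_isMaximal I (Q.map toFw.toRingHom) hQ

end LiftedChartIdeal

end Summit.MatrixMultiplication.MatrixMultiplication.Theorems.PairwiseCurvedTilingsLC.Negative
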